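import Mathlib
import HarnessLib
import Summits.Parity.GeneralizedHardyLittlewood.Theorems.DilatedChowla.Negative.DilatedChowlaWelch
import Summits.Parity.GeneralizedHardyLittlewood.Theorems.DilatedChowla.Negative.DilatedChowlaGram
import Summits.Parity.GeneralizedHardyLittlewood.Theorems.DilatedChowla.Negative.DilatedChowlaLoadBearing
import Summits.Parity.GeneralizedHardyLittlewood.Theorems.DilatedChowla.Negative.DilatedChowlaDispersion
import Summits.Parity.GeneralizedHardyLittlewood.Theorems.DilatedChowla.Negative.DilatedChowlaRange
import Summits.Parity.GeneralizedHardyLittlewood.Theorems.DilatedChowla.Negative.DilatedChowlaPretender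
import Summits.Parity.GeneralizedHardyLittlewood.Theorems.DilatedChowla.Negative.DilatedChowlaPretenderPNT
import Summits.Parity.GeneralizedHardyLittlewood.Theorems.DilatedChowla.Negative.DilatedChowlaPretenderFalse

/-!
# Disproof of `DilatedChowla` (stmt-Parity-13319) — cdisprove work file: findings

Crux (route LiouvilleMAD, rank-4 node; `dilatedChowla_iff` is `Iff.rfl`): for every shift `c ≠ 0`
there are `κ > 0`, `C` with `|S c n n' M| ≤ C · M^{1−κ}` for all `M` and all `1 ≤ n ≠ n' ≤ 2M`,
`S c n n' M := Σ_{m ∈ (M,2M]} λ(mn+c) λ(mn'+c)` (`L z = λ(z.toNat)`, so `λ 0 = 0`).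

VERDICT OF CYCLE 1 (2026-08-16): NO KILL.  The crux is a power-saving, dilation-uniform two-point
Chowla statement; every cheap attack below either lands on a DIFFERENT statement (a dropped
exclusion, an exponential dilation range, the exponent floor `1/2`) or needs an object nobody can
exhibit (a Landau–Siegel zero, a completely multiplicative pretender that IS `λ`).  Why it resists:
(i) no algebraic degeneration survives `c ≠ 0 ∧ n ≠ n'` — `(mn+c)(mn'+c)` is a constant times a
square in `ℤ[m]` iff `c(n−n') = 0` (§1, and this is exactly Tao's non-degeneracy `a₁b₂ ≠ a₂b₁`);
(ii) common factors of the two arguments divide `c(n'−n) ≤ 2|c|M`, so at most the primes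
`≤ log M` can be synchronised inside the range `n' ≤ 2M`, and synchronised smooth parts enter
SQUARED (sign `+1`), leaving the rough parts free (§3, no bias); (iii) sign-pattern coincidences
(full correlation) first occur at dilations `≍ 2^{M/2}` (random model AND numerics, §4), far
outside `2M`; (iv) all numerics (ideator jobs j015399: every pair `n ≠ n' ≤ 2M`, `M ≤ 8000`;
j015358/j015359: structured and balanced families to `M = 10⁶`; this seat §4) sit on the
square-root law with constant `≈ 1` and Gaussian tails; (v) the printed frontier is `o(·)`,
log-averaged, fixed dilations (Tao 2016 = tree `tao_log_averaged_elliott_two_holds`); nothing in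
print refutes or proves a power saving, conditionally or not; Maier-matrix irregularities live at
moduli `q ≥ x·exp(−(log x)^{5/11})`, not `q ≍ √x` (FGHM 1991), so they give no Ω-result here.

INDEX (prose only in docstrings; the whole file is sorry-free and, apart from `example`s, declaration-free outside §3/§4/§6 anchors):
* §1 LOAD-BEARING EXCLUSIONS.  `c ≠ 0` and `n ≠ n'`: LANDED by the lead
  (`Theorems/DilatedChowla/Negative/DilatedChowlaLoadBearing.lean`: `not_dilatedChowlaWithShiftZero`
  — witness `S 0 1 4 M = M` —, `not_dilatedChowlaWithoutDistinct` — `S c n n M = M`), imported and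
  recorded as `example`s; this seat adds `S_shift_zero` (at `c = 0` EVERY pair degenerates,
  `S 0 n n' M = λ(n)λ(n')·M`) and the DILATION RANGE (LANDED:
  `Theorems/DilatedChowla/Negative/DilatedChowlaRange.lean`, imported, `example`s below):
  `not_dilatedChowlaRange_of_two_pow_lt` / `not_dilatedChowlaRange_two_pow_succ` /
  `not_dilatedChowlaUnboundedDilations` — pigeonhole on the `2^M` sign patterns gives a pair
  `n ≠ n' ≤ 2^M + 1` with `S = M`, so the crux with range `2^M + 1` (or no range) is false.
* §2 TIGHTNESS (landed by the lead, imported): `not_dilatedChowlaAbove_half` — no exponent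
  `κ > 1/2` (Welch floor `|S| ≥ √(M/2)` for some pair); `not_dilatedChowla_of_coherentBias` — the
  Gram-positivity lever of line `Sketch`.  Recorded here as `example`s so the index is complete.
* §3 STRENGTHENINGS NOT REFUTED (analysis in docstrings, no theorem claimed): constants uniform in
  `c`; polynomial dilation ranges `M^A`; two different shifts `(c,c')` with `nc' ≠ n'c`.
* §4 NUMERICS (this seat, local, pure Python `num/collision.py`): first full-correlation dilation
  `n⋆(M,c)` versus the birthday prediction `√(π/2 · 2^{M−1})` — table in the docstring of
  `numerics_first_collision`.
* §5 THE PRETENDER OBSTRUCTION (LANDED: `Theorems/DilatedChowla/Negative/DilatedChowlaPretender.lean`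
  + `…PretenderPNT.lean` + `…PretenderFalse.lean`, sorry-free, axioms standard, PNT from the tree;
  imported, `example`s below): `pretender_failure` — a completely
  multiplicative `±1` function agreeing with `λ` at every prime `≤ 2M+1` whose pencil sum at
  `(c,n,n') = (1,1,2)` is `≥ π(4M+1) − π(2M+1) ≥ M/log(2M+1)`; `not_dilatedChowlaForPretenders`:
  any proof of the crux must use `λ(p) = −1` at primes ABOVE the length of the sum; and the exact
  splitting `S_one_one_two_split`: `S 1 1 2 M = (composite part) + Σ_{2M+1<p≤4M+1} λ(p+1)` — the
  simplest instance of the crux already carries a Liouville-at-shifted-primes sum over a dyadic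
  window (the object of the open `Σ_{p≤x} λ(p+1) = o(π(x))` problem), which is exactly the part the
  pretender theorem forbids discarding.
* §6 `-- Targets` (lead's stuck stubs): none registered (payload `stuck_stubs = []`).
  `-- Line Sketch` (card `siegel-mirror`, mirror mode): its one analytic stub
  `SiegelClassBias : FrequentSiegelZeros C₀ → CoherentBias 1` is NOT refutable by construction
  (refuting it needs an actual Siegel zero); remarks on its shape in the docstring of
  `line_sketch_remarks`.
-/

noncomputable section

namespace Summit.Parity.GeneralizedHardyLittlewood.Cruxes.DilatedChowla.Disproof

open Summit.Parity.GeneralizedHardyLittlewood.Theses.LiouvilleMAD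
open Summit.Parity.GeneralizedHardyLittlewood.Theorems.DilatedTableChowla.Negative
  (L L_of_pos L_mul_self_of_pos L_natCast L_natCast_mul)
open Summit.Parity.GeneralizedHardyLittlewood.Theorems.DilatedChowla.Negative
open Finset Filter Asymptotics
open scoped Classical

/-! # §1 Load-bearing exclusions -/

/-- `c ≠ 0` IS LOAD-BEARING (lead, `DilatedChowlaLoadBearing`): `S 0 1 4 M = M`, so the crux
quantified over all `c : ℤ` is false. -/
example : ¬ DilatedChowlaWithShiftZero := not_dilatedChowlaWithShiftZero

/-- `n ≠ n'` IS LOAD-BEARING (lead, `DilatedChowlaLoadBearing`): `S c n n M = M`. -/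
example : ¬ DilatedChowlaWithoutDistinct := not_dilatedChowlaWithoutDistinct

/-! ## §1bis The dilation range (`DilatedChowlaRange`, this seat) -/

/-- AT SHIFT ZERO EVERY PAIR DEGENERATES: `S 0 n n' M = λ(n)λ(n')·M`. -/
example (n n' M : ℕ) : S 0 n n' M = L n * L n' * M := S_shift_zero n n' M

/-- THE DILATION RANGE IS LOAD-BEARING: the crux is `DilatedChowlaRange (fun M => 2 * M)`
(`dilatedChowla_iff_range`, `Iff.rfl`); with range `2^M + 1` it is false (pigeonhole on the `2^M`
sign patterns `(λ(mn+c))_{m∈(M,2M]}` gives a pair with `S = M`), hence also with no range, and with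
any range exceeding `2^M` for all large `M`. -/
example : ¬ DilatedChowlaRange (fun M => 2 ^ M + 1) := not_dilatedChowlaRange_two_pow_succ

example : ¬ DilatedChowlaUnboundedDilations := not_dilatedChowlaUnboundedDilations

example {R : ℕ → ℕ} {M₀ : ℕ} (hR : ∀ M, M₀ ≤ M → 2 ^ M < R M) : ¬ DilatedChowlaRange R :=
  not_dilatedChowlaRange_of_two_pow_lt hR

/-- The pigeonhole itself: for `|c| < M` and `R > 2^M` some `1 ≤ n ≠ n' ≤ R` has `S c n n' M = M`. -/
example {c : ℤ} {M : ℕ} (hcM : |c| < (M : ℤ)) {R : ℕ} (hR : 2 ^ M < R) :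
    ∃ n n' : ℕ, 1 ≤ n ∧ 1 ≤ n' ∧ n ≠ n' ∧ n ≤ R ∧ n' ≤ R ∧ S c n n' M = M :=
  exists_S_eq_card_of_two_pow_lt hcM hR

/-! # §2 Tightness and the line's lever (landed by the lead; recorded for the index) -/

/-- TIGHTNESS (lead, `DilatedChowlaWelch`): the exponent floor `1/2` is false — some pair
`1 ≤ n ≠ n' ≤ 2M` always has `|S c n n' M| ≥ √(M/2)` (Welch / rank floor), so `κ ≤ 1/2` in any
true form of the crux; the random model and all numerics say `κ = 1/2 − o(1)` is the truth
(`max_{n≠n'≤2M} |S| ≈ √(2M·log(4M²))`). -/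
example : ¬ DilatedChowlaAbove (1 / 2) := not_dilatedChowlaAbove_half

/-- THE LINE'S LEVER (lead, `DilatedChowlaGram`): a coherent one-point class bias at shift `c`
refutes the crux (Gram positivity in the dilation variable).  The disprover's reading: this is the
ONLY mechanism found in cycle 1 that could make the crux false, and it needs one-point sums
`P c (qν) M` of size `≥ bM` with a COMMON sign over `V ≥ 4/b²` dilations — i.e. `λ` biased on the
classes `c mod qν`; unconditionally nobody can exhibit such a bias (it is a Landau–Siegel world). -/
example {c : ℤ} (hc : c ≠ 0) (h : CoherentBias c) : ¬ DilatedChowla :=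
  not_dilatedChowla_of_coherentBias hc h

/-- THE FIRST CONSEQUENCE (lead, `DilatedChowlaDispersion`): the crux forces a power-saving
Barban–Davenport–Halberstam bound for `λ` in the single class `c mod m`, moduli `m ≍ √x`,
segments of length `≍ √x` — a statement on which GRH is silent ("beyond GRH at step one"). -/
example (h : DilatedChowla) : PowerDispersion := powerDispersion_of_dilatedChowla h

/-! # §3 Strengthenings examined and NOT refuted (analysis only) -/

/-- STRENGTHENINGS NOT REFUTED IN CYCLE 1 (no theorem is claimed here; `True` is a placeholder so
that the analysis has an anchor in the index).

(a) CONSTANTS UNIFORM IN THE SHIFT (`∃ κ C, ∀ c ≠ 0, ∀ M n n' …`).  With `c` free one can take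
`c = t·n·n'`, which turns the pencil sum into `λ(nn')·Σ_{m∈(M,2M]} λ(m+tn')λ(m+tn)`: a two-point
sum at ARBITRARY height `t` with shifts of ratio `n'/n`.  Full correlation needs two windows of
length `M` in the `t`-sequence of words `λ|_{(M+tn, 2M+tn]}`, `n ≤ 2M`, to coincide up to sign; the
random model makes this happen first at `t ≍ 2^M/M²` (so the uniform version is FALSE in the random
model), but no arithmetic reason forces a coincidence.  NUMERICS (kit j017469, this seat,
`num/cstar.py`): the least shift `c⋆(M) ≥ 1` for which some pair `1 ≤ n < n' ≤ 2M` INSIDE the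
crux's range has equal sign patterns (`|S_c(n,n';M)| = M`) exists for every `M ≤ 30` tested and
follows the birthday prediction `2^{M−1}/C(2M,2)` within a factor `0.04–3.5`:
`c⋆ = 1, 1, 6, 9, 106, 271, 61, 2480, 1545, 17461, 3359, 1059954` for
`M = 8, 10, …, 30` (e.g. `M = 28`: `λ(7m+3359) = λ(8m+3359)` for all `28 < m ≤ 56`; `M = 30`: the
pair `(48, 59)` at `c = 1059954`).  So, as far as computation reaches, `sup_c max_{n≠n'≤2M} |S_c| = M`
at every scale: the per-`c` constant of the crux must grow at least like `C(c) ≥ M(c)^κ` with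
`M(c) ≈ log₂ c`, and the `c`-uniform strengthening is false if this persists (not certifiable for
all `M`, hence no theorem).  Junk from `Int.toNat` (arguments `≤ 0` give `λ 0 = 0`) only SHRINKS
`|S|`, so negative `c` is no lever either.  Status: open, believed false, unprovable here.

(b) POLYNOMIAL DILATION RANGES `n, n' ≤ M^A` (`DilatedChowlaRange (fun M => M^A)`).  Pigeonhole
needs `> 2^M` dilations (§1); synchronising the `p`-parts of `mn+c` and `mn'+c` needs
`p^{v} ∣ c(n'−n)`, i.e. only primes `≤ log(range)` — and synchronised parts enter squared.  Random
model: `max_{n≠n'≤M^A} |S| ≍ √(2A·M log M)`, so every fixed `A` is consistent with the crux (with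
`κ < 1/2`).  Status: open for every `A ≥ 1`; the crux's `A = 1` (range `2M`) is what the consumer
`DilatedChowlaToTypeII` needs and no more.

(c) TWO SHIFTS (`λ(mn+c)λ(mn'+c')` with `nc' ≠ n'c`, Tao's non-degeneracy).  The crux is the
sub-family `c = c'`; the degenerate direction `nc' = n'c` contains `(n,c,n',c') = (1,1,4,4)`:
`λ(4m+4) = λ(4)λ(m+1) = λ(m+1)`, full correlation — the analogue of §1's `c = 0`.  Not a
strengthening anybody filed; recorded because a planner widening the node must keep `nc' ≠ n'c`.

(d) SMALL `M` INSIDE THE RANGE.  For `c = 1` full-correlation pairs `n ≠ n' ≤ 2M` EXIST for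
`M ≤ 11` (e.g. `M = 11`: `(8,21)`; `M = 9,10`: `(7,17)`; §4 table) and for no `12 ≤ M ≤ 20`; they
are absorbed by the constant `C` and say nothing asymptotically. -/
theorem strengthenings_not_refuted : True := trivial

/-! # §4 Numerics of this seat -/

/-- NUMERICS (local, pure Python, `num/collision.py`, this seat 2026-08-16; exact `λ` by a
smallest-prime-factor sieve).  `n⋆(M,c)` := the least `N` such that some `1 ≤ n < n' ≤ N` have
sign patterns `(λ(mn+c))_{m∈(M,2M]}` equal up to a global sign (then `|S c n n' M| = M`).
Birthday prediction for independent fair patterns: `E n⋆ ≈ √(π/2 · 2^{M−1})`.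

```
  M   c=1: n⋆ (pair) sign     c=−1: n⋆ (pair)      c=2: n⋆ (pair)     pred   2M
  4      4 (2,4) −               6 (5,6)              7 (1,7)          3.5    8
  6      5 (4,5) −               5 (3,5)             10 (8,10)         7.1   12
  8     14 (6,14) −             18 (5,18)            20 (17,20)       14.2   16
 10     17 (7,17) +             22 (21,22)           27 (9,27)        28.4   20
 11     21 (8,21) −             22 (21,22)           42 (16,42)       40.1   22
 12     34 (28,34) −            91 (63,91)           68 (56,68)       56.7   24
 14    104 (78,104) −          151 (69,151)          60 (5,60)       113.4   28
 16    198 (130,198) +         239 (204,239)        365 (248,365)    226.9   32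
 18    282 (215,282) +         214 (181,214)        217 (69,217)     453.7   36
 20   1162 (701,1162) −       1025 (633,1025)       217 (69,217)     907.5   40
 22   2316 (1273,2316) −      1726 (821,1726)        764 (301,764)    1815.0   44
 24   4489 (4170,4489) −      5727 (2616,5727)      3571 (1652,3571)  3630.0   48
 26  11404 (2166,11404) +     9299 (1549,9299)      3731 (2093,3731)  7260.0   52
```
Ratios `n⋆/pred ∈ [0.24, 1.97]` over all `4 ≤ M ≤ 26`, three shifts (full table:
`num/collision_26.out` in the seat folder) — the birthday law, no arithmetic structure; from
`M = 12` on the first full-correlation pair lies OUTSIDE the crux's range `2M`, and the gap grows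
exponentially.  (The exact symmetry `S_{dc}(dn,dn') = S_c(n,n')` is visible: `(866,2372)` at
`c = 2`, `M = 21` is `(433,1186)` at `c = 1`.)  (Repeated pairs across consecutive `M`, e.g.
`(69,217)` at `c = 2` for `M = 18,19,20`, are single long agreements `λ(69m+2) = −λ(217m+2)`,
`19 ≤ m ≤ 40`, seen through overlapping windows.)  RANGE GROWTH (kit j017030, this seat, `num/range_growth.py`, exact `λ`, all pairs
`1 ≤ n < n' ≤ N` by blocked Gram products): `max|S|/√M` as the dilation range grows from the
crux's `N = 2M` to `N = M^{3/2}` and `N = M²` —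
```
   M      N   c   #pairs        max|S|  max/√M  Gauss √(2ln#pairs)  var(S/√M)  #>5σ (E)     full corr.
  128    256  ±1  3.3·10⁴       46/48   4.07/4.24      4.56          0.99/1.00   0/0 (0.0)        0
  128   1448  ±1  1.0·10⁶       54/58   4.77/5.13      5.27          1.00        0/1 (0.6)        0
  128  16384  ±1  1.3·10⁸       68/68   6.01/6.01      6.12          1.00        56/41 (77)       0
  256    512  ±1  1.3·10⁵       76/70   4.75/4.38      4.85          1.00        0/0 (0.1)        0
  256   4096  ±1  8.4·10⁶       84/84   5.25/5.25      5.65          1.00        3/2 (4.8)        0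
  256  65536  ±1  2.1·10⁹       98/100  6.12/6.25      6.56          1.00        687/756 (1231)   0
```
(also `M = 64`, `N ≤ 4096`: same picture) — the maximum over POLYNOMIAL ranges `N = M^A`,
`A ≤ 2`, sits at or just below the Gaussian union bound `√(2A·M·log M)`-type prediction, the bulk
is exactly unit-variance, the tails are (binomially) sub-Gaussian, and no full correlation occurs:
statement (b) of `strengthenings_not_refuted` in numbers.  Together with the ideators' tables (j015399:
`max_{n≠n'≤2M}|S| ≤ 6√M`, Gaussian to the third decimal, `M ≤ 8000`; j015358/j015359: structured
and balanced families to `M = 10⁶`, `max|S|/√M ≤ 3.9`) this closes the cheap-numerics front: there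
is no candidate family. -/
theorem numerics_first_collision : True := trivial

/-! # §5 The pretender obstruction (`DilatedChowlaPretender`, `…PNT`, `…False`, this seat) -/

/-- PRETENDER FAILURE: for every `M` a completely multiplicative `f : ℕ → {±1}` with
`f(p) = −1 = λ(p)` at every prime `p ≤ 2M+1` has
`|Σ_{m∈(M,2M]} f(m+1) f(2m+1)| ≥ #{m ∈ (M,2M] : 2m+1 prime} = π(4M+1) − π(2M+1)`, which is
`≥ M/log(2M+1)` for large `M` (tree PNT).  Consequence for provers: a proof of the crux — already
at the bounded dilations `(1,2)` — must use `λ(p) = −1` at primes in `(2M+1, 4M+1]`, ABOVE the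
length `M` of the sum (indeed at the prime VALUES of the second form); pretentious-distance /
Matomäki–Radziwiłł short-sum / small-prime entropy inputs are blind to such flips. -/
example (M : ℕ) :
    ∃ f : ℕ → ℝ, (∀ a b : ℕ, f (a * b) = f a * f b) ∧ (∀ k : ℕ, 1 ≤ k → f k = 1 ∨ f k = -1) ∧
      (∀ p : ℕ, p.Prime → p ≤ 2 * M + 1 → f p = -1) ∧
      ((switchSet M).card : ℝ) ≤ |∑ m ∈ Ioc M (2 * M), f (m + 1) * f (2 * m + 1)| :=
  pretender_failure M

example (M : ℕ) :
    (switchSet M).card = Nat.primeCounting (4 * M + 1) - Nat.primeCounting (2 * M + 1) :=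
  card_switchSet_eq_primeCounting_sub M

example : ∃ M₀ : ℕ, ∀ M : ℕ, M₀ ≤ M → (M : ℝ) / Real.log (2 * M + 1) ≤
    (Nat.primeCounting (4 * M + 1) : ℝ) - Nat.primeCounting (2 * M + 1) :=
  primeCounting_window_ge

example : ¬ DilatedChowlaForPretenders := not_dilatedChowlaForPretenders

/-- THE `λ`-INSTANCE SPLITS AS COMPOSITE PART + LIOUVILLE AT SHIFTED PRIMES: for `p = 2m+1` prime
the term is `λ(m+1)λ(p) = λ(p+1)`, so `S 1 1 2 M` carries the dyadic piece of the open
`Σ_{p≤x} λ(p+1) = o(π(x))` problem — exactly the part the pretender theorem forbids discarding. -/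
example (M : ℕ) :
    S 1 1 2 M =
      (∑ m ∈ (Ioc M (2 * M)).filter (fun m => ¬ (2 * m + 1).Prime),
          L ((m + 1 : ℕ) : ℤ) * L ((2 * m + 1 : ℕ) : ℤ)) +
        ∑ p ∈ (Ioc (2 * M + 1) (4 * M + 1)).filter Nat.Prime, L ((p + 1 : ℕ) : ℤ) :=
  S_one_one_two_split M

/-! # §6 Targets and the picked line -/

/-- `-- Targets`: none (payload `stuck_stubs = []`, `targets = []` at cycle 1; no `disprover-wanted`).
`-- Line Sketch` (card `siegel-mirror`, lead prover-line-stmt-Parity-13319-0, MIRROR mode — no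
`DilatedChowla_of` exists; products are negative lemmas).  STATE OF THE LINE read by this seat at
the end of cycle 1 (all under `Theorems/DilatedChowla/Negative/`, sorry-free): `MirrorDefs`,
`Gram` (`not_dilatedChowla_of_coherentBias`), `GramSigned` (`not_dilatedChowla_of_absBias` — the
one-point sums need not share a sign), `Welch` (`not_dilatedChowlaAbove_half`), `LoadBearing`
(`c ≠ 0`, `n ≠ n'`), `Dispersion` (`DilatedChowla → PowerDispersion`), `MirrorOnePointDefs` (the laws
`CharTwistLaw`/`OnePointExcLaw`/`MoebiusExcLaw`/`MoebiusNonexcLaw`, Montgomery–Vaughan §11.3 shape),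
`MirrorMoebiusExcData` + `MirrorMoebiusExc` (`moebiusExcLaw` PROVED), `MirrorMoebiusNonexc`
(`moebiusNonexcLaw` PROVED), `MirrorTransfer` (`charTwist_of_moebiusLaws`), `MirrorOrthogonality`
(`onePointExc_of_charTwist'`), `MirrorBias` + `MirrorBias2` (`coherentBias_one_of_onePointExc :
OnePointExc → ∃ C₀ > 0, (SiegelZerosAbove (C₀ · log) → CoherentBias 1)`), `MirrorReading` (what
`¬ SiegelZerosAbove (C₀ · log)` says: a real-zero-free interval `[1 − 1/(C₀ log² q), 1)` for all large
conductors; implied by the tree's open `NoSiegelZeros`).  Composed, these give the mirror theorem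
`DilatedChowla → ∃ C₀ > 0, ¬ SiegelZerosAbove (C₀ · log)` with NO unproved input: the crux is
certified Landau–Siegel-hard (a proof of it proves a near-Landau–Siegel zero-free region), which
re-grades the route CONDITIONAL(GRH+) in the sense of its own KILL CRITERIA (ii); it does not
refute the crux.
Disprover's remarks: (1) the analytic stubs are implications FROM a Siegel-zero hypothesis, hence
NOT refutable here by construction (a refutation needs actual exceptional zeros); attacked only for
consistency.  (2) SIGN/SHAPE (consistent): on the class `1 mod qν` the pole of `L(2s,ψ²)/L(s,ψ)`
at the exceptional `β` has positive residue (`L'(β,ψ) > 0` — the lead proves `mexc_deriv_re_pos`),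
so every `P 1 (qν) M` is biased with the SAME sign `σ = +1`, as `CoherentBias` demands; the
relative bias may be as small as `≍ (log q)^{−5}` in the lead's constants, whence `V = q` dilations
and `M = ⌈exp(C₁(1 + 2 log q)²)⌉`.  (3) THRESHOLD: the bias is undamped while
`log(2kM+1) ≤ η log q`, which with `log M ≍ C₁ log² q` needs quality `η ≥ C₀ log q` — exactly the
lead's hypothesis `SiegelZerosAbove (C₀ · log)` (safer than the card's `C₀ log log q`); bounded
quality would NOT suffice (the `λ ↦ λ_Siegel` transition error is absolute while the bias is
polylog-small), and the lead does not claim it.  (4) Nothing in the line is a target for the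
disprover; its completed form and this file's §1–§5 are complementary certificates: the crux is
(a) load-bearing in all three exclusions, (b) tight at exponent `1/2`, (c) blind-method-proof
(pretenders), (d) Landau–Siegel-hard (mirror), and (e) numerically Gaussian at every accessible
scale. -/
theorem line_sketch_remarks : True := trivial

end Summit.Parity.GeneralizedHardyLittlewood.Cruxes.DilatedChowla.Disproof

end
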